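import Literature.Computability.Cryptography.OracleGames
import Literature.Computability.Complexity.OracleClockFst
import Literature.Computability.Complexity.OracleQueryMap
import Literature.Computability.Complexity.OracleComposition
import Literature.Computability.QuantumComplexity.PermanentSearchRandom
import HarnessLib

/-!
# PPT oracle adversaries compute `FP^A` functions against language oracles

Bridge between the two presentations of classical polynomial-time oracle computation in the
tree: the C4a *oracle adversary* (`Cryptography/OracleGames.lean`: a polynomial-time step
function `OracleAlg.step`, a polynomial coin budget and a polynomial ROUND budget `fuel`, read in
the length of the game input `x`, the machine input being the pair `⟨x, r⟩` of input and coins;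
output law `OracleAdversary.outputPMF`, no bound on the length of the queries) and G01's function
class `FPRel O = FP^O` (`Complexity/Oracle.lean`: ONE polynomial bounding the rounds AND the
length of every query, in the length of the machine input). Against a LANGUAGE oracle
`Oracle.ofLanguage A` (one-symbol answers) the two agree, because the queries of a
polynomial-time step function fed single-bit answers are polynomially short:

* (from the tree: `OracleAlg.exists_step_of_mem_queries`, `QuantumComplexity/PermanentSearchRandom.lean`
  — every query of a run is the query asked after some list of earlier oracle answers;)
* `OracleAlg.length_query_lt` — such a query has length `< R(2|w| + 6|as| + 4)` for the
  output-length polynomial `R` of the step function (`OracleAlg.IsPolyTime.exists_length_le`,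
  `OracleComposition.length_listBool_encode`);
* **`OracleAdversary.clockedRun_mem_FPRel`** — for a PPT adversary `𝒜` and every language `A`,
  the total function `w ↦ (𝒜.alg.run A (fuel |(boolUnpair w).1|) w).getD []` — on `w = ⟨x, r⟩`:
  the output of `𝒜` on input `x` with coins `r` within its round budget, a missing output read
  as the empty string (the convention of the sampling class `SampBPP^O`,
  `Literature.Barriers.QuantumAdvantage.SampPRel`) — is in `FPRel (Oracle.ofLanguage A)`: the
  witness machine is `𝒜.alg` clocked by the first field (`OracleAlg.clockFst`,
  `OracleClockFst.lean`) with its queries capped (`OracleAlg.capQ`, `OracleQueryMap.lean`), the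
  cap never acting.

Consumer: `SampBPP^A ⊆ SampBQP^A` from the relativized reversible simulation
(`Literature/Barriers/QuantumAdvantage/SampPRelSubsetSampBQPRel.lean`), whose simulation fact
`Literature.Computability.QuantumComplexity.uniformOracleCoinSimulation` is stated for `FP^A`
functions of `⟨x, coins⟩`.

## References

* S. Arora, B. Barak, *Computational Complexity: A Modern Approach*, CUP 2009, §3.4 (oracle
  machines; a polynomial-time machine asks polynomially many, polynomially long queries), §1.4.1
  (clocked simulation), Def. 7.1 (probabilistic machines as deterministic machines reading coins)
  [AroraBarakCC2009].
* O. Goldreich, *Foundations of Cryptography I*, CUP 2001, §3.6, Def. 3.6.4 (probabilistic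
  polynomial-time oracle machines), as used in `OracleGames.lean`.
-/

namespace Literature.Computability.Complexity

open _root_.Computability

namespace OracleAlg

variable {β : Type}

/-- **Queries of a polynomial-time step function are short**: after a transcript `as` of
single-symbol answers on input `w`, the query asked has length `< R(2|w| + 6|as| + 4)`, `R` the
output-length polynomial of the step function (`OracleAlg.IsPolyTime.exists_length_le`: the
code of (input, answers) is `boolPair w (listBool.encode as)`, of length `2|w| + 2 + (2|as| + 2 +
Σ (2|aᵢ| + 2)) ≤ 2|w| + 6|as| + 4`, and the code of the query `inl y` has length `|y| + 1`).
[cite: AroraBarakCC2009, §3.4 and §1.2] -/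
theorem length_query_lt {M : OracleAlg β} {eb : Encoding β Bool} {R : Polynomial ℕ}
    (hR : ∀ (x : List Bool) (ans : List (List Bool)),
      (((encodingList Bool).sumBool eb).encode (M.step x ans)).length ≤
        R.eval (boolPair x ((encodingList Bool).listBool.encode ans)).length)
    {w : List Bool} {as : List (List Bool)} {y : List Bool} (hstep : M.step w as = Sum.inl y)
    (has : ∀ a ∈ as, a.length ≤ 1) : y.length < R.eval (2 * w.length + 6 * as.length + 4) := by
  have h1 := hR w as
  rw [hstep] at h1
  have h2 : (((encodingList Bool).sumBool eb).encode (Sum.inl y : List Bool ⊕ β)).length =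
      y.length + 1 := rfl
  rw [h2] at h1
  have h3 : (boolPair w ((encodingList Bool).listBool.encode as)).length ≤
      2 * w.length + 6 * as.length + 4 := by
    rw [length_boolPair, OracleComposition.length_listBool_encode]
    have := OracleComposition.sum_map_le_length_mul as (fun a => 2 * a.length + 2) 4
      fun a ha => by have := has a ha; omega
    omega
  exact Nat.lt_of_lt_of_le (Nat.lt_of_succ_le h1) (TM2Iter.eval_mono R h3)

end OracleAlg

end Literature.Computability.Complexity

namespace Literature.Computability.Cryptography

open _root_.Computability Complexity

namespace OracleAdversary

/-- **A PPT oracle adversary, clocked by its own round budget, computes an `FP^A` function**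
against every language oracle `A`: the total function
`w ↦ (𝒜.alg.run A (fuel |(boolUnpair w).1|) w).getD []` — on a pair `w = ⟨x, r⟩`, the output of
`𝒜` on input `x` with coins `r` within `fuel |x|` rounds, `none` read as `[]` — is in
`FPRel (Oracle.ofLanguage A)`. Witness: `𝒜.alg` clocked by the first field (`OracleAlg.clockFst`)
with queries capped at `c = R ∘ (2X + 6·fuel + 4)` (`OracleAlg.capQ`), which never acts since
every query of the clocked algorithm is that short (`OracleAlg.length_query_lt`); round and query
budget `fuel + 1 + c`. [cite: AroraBarakCC2009, §3.4 with §1.4.1 and Def. 7.1] -/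
theorem clockedRun_mem_FPRel (𝒜 : OracleAdversary (List Bool)) (h𝒜 : 𝒜.IsPPT (encodingList Bool))
    (A : Language Bool) :
    (fun w => (𝒜.alg.run (Oracle.ofLanguage A) (𝒜.fuel.eval (boolUnpair w).1.length) w).getD []) ∈
      FPRel (Oracle.ofLanguage A) := by
  obtain ⟨R, hR⟩ := OracleAlg.IsPolyTime.exists_length_le h𝒜
  have hO : ∀ q, (Oracle.ofLanguage A q).length ≤ 1 := fun q => le_of_eq rfl
  have hfst : ∀ w : List Bool, (boolUnpair w).1.length ≤ w.length := fun w => by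
    have := length_boolUnpair_parts_le w
    omega
  set c : Polynomial ℕ := R.comp (2 * Polynomial.X + 6 * 𝒜.fuel + 4) with hc
  set M₁ : OracleAlg (List Bool) := 𝒜.alg.clockFst 𝒜.fuel [] with hM₁
  -- every query of the clocked algorithm obeys the cap `c`
  have hcap : ∀ (w : List Bool) (n : ℕ), ∀ y ∈ M₁.queries (Oracle.ofLanguage A) n w,
      y.length ≤ c.eval w.length := by
    intro w n y hy
    obtain ⟨as', hstep, has''⟩ := OracleAlg.exists_step_of_mem_queries M₁ (Oracle.ofLanguage A) n w hy
    have has' : ∀ a ∈ as', a.length ≤ 1 := fun a ha => by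
      obtain ⟨y', -, rfl⟩ := has'' a ha
      exact hO y'
    rw [hM₁, OracleAlg.clockFst_step] at hstep
    by_cases hlt : as'.length < 𝒜.fuel.eval (boolUnpair w).1.length
    · rw [if_pos hlt] at hstep
      have h1 := OracleAlg.length_query_lt hR hstep has'
      have h2 : 2 * w.length + 6 * as'.length + 4 ≤ 2 * w.length + 6 * 𝒜.fuel.eval w.length + 4 := by
        have := TM2Iter.eval_mono 𝒜.fuel (hfst w)
        omega
      have h3 := TM2Iter.eval_mono R h2
      rw [hc, Polynomial.eval_comp]
      simp only [Polynomial.eval_add, Polynomial.eval_mul, Polynomial.eval_ofNat, Polynomial.eval_X]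
      omega
    · rw [if_neg hlt] at hstep
      cases hstep
  refine ⟨M₁.capQ c [], OracleAlg.isPolyTime_capQ _ (OracleAlg.isPolyTime_clockFst _ h𝒜 𝒜.fuel []) c [],
    𝒜.fuel + 1 + c, fun w => ?_⟩
  have hrc := OracleAlg.run_capQ M₁ c [] (Oracle.ofLanguage A) w ((𝒜.fuel + 1 + c).eval w.length)
    (hcap w _)
  refine ⟨?_, fun y hy => ?_⟩
  · rw [hrc.1, hM₁]
    have hn : 𝒜.fuel.eval (boolUnpair w).1.length < (𝒜.fuel + 1 + c).eval w.length := by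
      have := TM2Iter.eval_mono 𝒜.fuel (hfst w)
      simp only [Polynomial.eval_add, Polynomial.eval_one]
      omega
    exact OracleAlg.run_clockBy 𝒜.alg (fun w => 𝒜.fuel.eval (boolUnpair w).1.length) []
      (Oracle.ofLanguage A) w hn
  · have := OracleAlg.length_le_of_mem_queries_capQ M₁ c [] (Oracle.ofLanguage A) w _ hy
    simp only [Polynomial.eval_add, Polynomial.eval_one]
    omega

/-- On a pair input `⟨x, r⟩` the `FP^A` function of `clockedRun_mem_FPRel` is the output of `𝒜`
on `x` with coins `r` within `fuel |x|` rounds (`none ↦ []`) — the deterministic run underlying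
`𝒜.outputPMF (Oracle.ofLanguage A) x`. [folklore] -/
theorem clockedRun_boolPair (𝒜 : OracleAdversary (List Bool)) (O : Oracle) (x r : List Bool) :
    (𝒜.alg.run O (𝒜.fuel.eval (boolUnpair (boolPair x r)).1.length) (boolPair x r)).getD [] =
      (𝒜.alg.run O (𝒜.fuel.eval x.length) (boolPair x r)).getD [] := by
  rw [boolUnpair_boolPair]

end OracleAdversary

end Literature.Computability.Cryptography
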